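import Summits.Ventures.PercRepro.RankLevelSetLevelSevenT14Dev1
import Summits.Ventures.PercRepro.RankLevelSetLevelSevenT14Dev2
import Summits.Ventures.PercRepro.RankLevelSetLevelSevenT14Dev3
import Summits.Ventures.PercRepro.RankLevelSetLevelSevenT14Dev4
import Summits.Ventures.PercRepro.S4MidKeyFourteen
import Summits.Ventures.PercRepro.S4SevenWindow
import Summits.Ventures.PercRepro.RankLevelSetLevelSixRowsNineToFifteen

/-!
# PercRepro — THE 14 ROW OF LEVEL `7`: `c025_core_seven_fourteen (d ≥ 8) : RLS M 14 7` ON EVERY `e`-FREE CORE OF RANK `14`, AND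
**THEOREM C₇ AT RANK `14`** (p7 g24, S4 feeder; p8's assembly shape — NO window claim, p9 owns S4)

The core cells `(14, d)`: `8 ≤ d ≤ 74` by the coloop device with the lossy ladder (`c025_core_seven_fourteen_<d>`: `k` coloops reduce to the natural cell
`(14 − k, d)` of the row `14 − k` at the same corank, the rest retired — the generic device `c025_core_seven_of_cells_free` in RankLevelSetLevelSevenT14Dev1, RankLevelSetLevelSevenT14Dev2, RankLevelSetLevelSevenT14Dev3, RankLevelSetLevelSevenT14Dev4),
`d ≥ 75` by p1's middle key (`S4Mid.c025_core_seven_midkey_fourteen`, no coloop-freeness needed). Then the level-6 glue `rls_seven_at_of_core 14` on `c025_six_all`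
(level `6` at `p = 13`) gives level `7` at `p = 14`: **`c025_seven_at_fourteen : RLS M 14 7`** for every finite matroid.
Axioms: standard.
-/

open scoped Matroid

namespace PercRepro

namespace ThmN

variable {α : Type}

/-- **The core cell `(14, d)` at every corank `d ≥ 8`, every `e`-free core.** -/
theorem c025_core_seven_fourteen (M : Matroid α) [M.Finite] (d : ℕ) (hd8 : 8 ≤ d)
    (hR : M.eRank = (14 : ℕ∞)) (hn : M.E.ncard = 14 + d)
    (hfree : ∀ e ∈ M.E, ∃ A ⊆ M.E \ {e}, e ∉ M.closure A ∧ e ∉ M.closure ((M.E \ {e}) \ A)) :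
    RLS M 14 7 := by
  rcases Nat.lt_or_ge d 75 with hlt | hge
  · interval_cases d
    · exact c025_core_seven_fourteen_8 M hR hn hfree
    · exact c025_core_seven_fourteen_9 M hR hn hfree
    · exact c025_core_seven_fourteen_10 M hR hn hfree
    · exact c025_core_seven_fourteen_11 M hR hn hfree
    · exact c025_core_seven_fourteen_12 M hR hn hfree
    · exact c025_core_seven_fourteen_13 M hR hn hfree
    · exact c025_core_seven_fourteen_14 M hR hn hfree
    · exact c025_core_seven_fourteen_15 M hR hn hfree
    · exact c025_core_seven_fourteen_16 M hR hn hfree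
    · exact c025_core_seven_fourteen_17 M hR hn hfree
    · exact c025_core_seven_fourteen_18 M hR hn hfree
    · exact c025_core_seven_fourteen_19 M hR hn hfree
    · exact c025_core_seven_fourteen_20 M hR hn hfree
    · exact c025_core_seven_fourteen_21 M hR hn hfree
    · exact c025_core_seven_fourteen_22 M hR hn hfree
    · exact c025_core_seven_fourteen_23 M hR hn hfree
    · exact c025_core_seven_fourteen_24 M hR hn hfree
    · exact c025_core_seven_fourteen_25 M hR hn hfree
    · exact c025_core_seven_fourteen_26 M hR hn hfree
    · exact c025_core_seven_fourteen_27 M hR hn hfree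
    · exact c025_core_seven_fourteen_28 M hR hn hfree
    · exact c025_core_seven_fourteen_29 M hR hn hfree
    · exact c025_core_seven_fourteen_30 M hR hn hfree
    · exact c025_core_seven_fourteen_31 M hR hn hfree
    · exact c025_core_seven_fourteen_32 M hR hn hfree
    · exact c025_core_seven_fourteen_33 M hR hn hfree
    · exact c025_core_seven_fourteen_34 M hR hn hfree
    · exact c025_core_seven_fourteen_35 M hR hn hfree
    · exact c025_core_seven_fourteen_36 M hR hn hfree
    · exact c025_core_seven_fourteen_37 M hR hn hfree
    · exact c025_core_seven_fourteen_38 M hR hn hfree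
    · exact c025_core_seven_fourteen_39 M hR hn hfree
    · exact c025_core_seven_fourteen_40 M hR hn hfree
    · exact c025_core_seven_fourteen_41 M hR hn hfree
    · exact c025_core_seven_fourteen_42 M hR hn hfree
    · exact c025_core_seven_fourteen_43 M hR hn hfree
    · exact c025_core_seven_fourteen_44 M hR hn hfree
    · exact c025_core_seven_fourteen_45 M hR hn hfree
    · exact c025_core_seven_fourteen_46 M hR hn hfree
    · exact c025_core_seven_fourteen_47 M hR hn hfree
    · exact c025_core_seven_fourteen_48 M hR hn hfree
    · exact c025_core_seven_fourteen_49 M hR hn hfree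
    · exact c025_core_seven_fourteen_50 M hR hn hfree
    · exact c025_core_seven_fourteen_51 M hR hn hfree
    · exact c025_core_seven_fourteen_52 M hR hn hfree
    · exact c025_core_seven_fourteen_53 M hR hn hfree
    · exact c025_core_seven_fourteen_54 M hR hn hfree
    · exact c025_core_seven_fourteen_55 M hR hn hfree
    · exact c025_core_seven_fourteen_56 M hR hn hfree
    · exact c025_core_seven_fourteen_57 M hR hn hfree
    · exact c025_core_seven_fourteen_58 M hR hn hfree
    · exact c025_core_seven_fourteen_59 M hR hn hfree
    · exact c025_core_seven_fourteen_60 M hR hn hfree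
    · exact c025_core_seven_fourteen_61 M hR hn hfree
    · exact c025_core_seven_fourteen_62 M hR hn hfree
    · exact c025_core_seven_fourteen_63 M hR hn hfree
    · exact c025_core_seven_fourteen_64 M hR hn hfree
    · exact c025_core_seven_fourteen_65 M hR hn hfree
    · exact c025_core_seven_fourteen_66 M hR hn hfree
    · exact c025_core_seven_fourteen_67 M hR hn hfree
    · exact c025_core_seven_fourteen_68 M hR hn hfree
    · exact c025_core_seven_fourteen_69 M hR hn hfree
    · exact c025_core_seven_fourteen_70 M hR hn hfree
    · exact c025_core_seven_fourteen_71 M hR hn hfree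
    · exact c025_core_seven_fourteen_72 M hR hn hfree
    · exact c025_core_seven_fourteen_73 M hR hn hfree
    · exact c025_core_seven_fourteen_74 M hR hn hfree
  · exact S4Mid.c025_core_seven_midkey_fourteen M (by omega) hfree

/-- **THEOREM C₇ AT RANK `14`**: level `7` at `p = 14` for every finite matroid (on level `6` at `p = 13`, `c025_six_all`). -/
theorem c025_seven_at_fourteen (M : Matroid α) [M.Finite] : RLS M 14 7 :=
  rls_seven_at_of_core 14 (by norm_num) (fun M _ => c025_six_all M 13 (by norm_num))
    (fun M _ d hd hR hn hfree => c025_core_seven_fourteen M d hd hR hn hfree) M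

end ThmN

end PercRepro
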